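import Summits.CriticalPhenomena.Ising3D.Control2DTaylorCertificate
import Mathlib.Tactic.Linarith
import Mathlib.Tactic.Positivity
import HarnessLib

/-!
# Kind-`box` 2D γ-certificates at `z = z̄ = 1/2` in explicit form with a spin-dependent truncation order
(cell `pub-ising3x`, seat controls-1 gen 16; KERNEL PATH for the 2D γ-certificates, Λ = 11 box kind — CONTROL-ONLY)

HONEST FRAMING: lottery ticket; floor = tightest certified 3D Ising CFT bounds; no exact-solution
claim without a proof. CONTROL-ONLY (`d = 2`, axiom set `A2D′`); nothing numerical is asserted here.

`boxObligations_half_of_explicit` / `excludedOn_half_of_explicit` / `boxExcluded_half_of_explicit` (g14,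
`Control2DTaylorCertificate`) take ONE truncation order `N ≥ E₀` for every cell. A kernel replay uses a
different order per spin (more z-series levels where the functional nearly vanishes, fewer elsewhere —
`gapExcluded_half_of_explicitN`, g15). This file states the per-cell-`N` forms for kind `box`: each cell
hypothesis becomes `∃ N, E₀ ≤ N ∧ 0 ≤ φ[F_-[Q_N(Δ, ℓ)]]`; otherwise verbatim, same proof
(`blockPositive_of_QN_nonneg_taylor` is applied with the witness). [cite: RattazziEtAl2008, §5.5]
-/

namespace Summit.CriticalPhenomena.Ising3D.Control2D

open Finset Set
open Literature.MathematicalPhysics.QuantumFieldTheory.ConformalBootstrap3D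

/-- **Kind `box` at `(1/2,1/2)`, explicit form, per-cell truncation orders — the obligations record.**
For `φ = taylorFunctional2D (1/2) S w`, threshold `E₀` and a box with `e₁ ≥ 0`: (I), (R) as in
`boxObligations_half_of_explicit`; every cell ((E) at `ℓ = 0` on `[e₁, e₂]`, (C′) at `ℓ = 0` on `[G, E₀)`,
at `ℓ = 2` on `[2+δ, E₀)`, at even `ℓ ≥ 4` on `[ℓ, E₀)`, (T) at `(2,2)`) with its own witness `N ≥ E₀`.
PROVED. [cite: RattazziEtAl2008, §5.5] -/
theorem boxObligations_half_of_explicitN (S : Finset (ℕ × ℕ)) (w : ℕ × ℕ → ℝ)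
    {s G δ e₁ e₂ E₀ : ℝ} (he₁ : 0 ≤ e₁) (hG0 : 0 ≤ G) (hδ : 0 ≤ δ)
    (hI : 0 < taylorFunctional2D (1 / 2) S w (crossF s (-1) (fun _ _ => (1 : ℝ))))
    (hR : ∀ (b : ℝ) (J : ℕ), 0 ≤ b → E₀ ≤ 2 * b + J →
      0 ≤ ∑ p ∈ S, w p * ((1 - (-1 : ℝ) ^ (p.1 + p.2)) * 2 ^ (p.1 + p.2) *
        (qFactor₁ s (b + J) p.1 * qFactor₁ s b p.2 + qFactor₁ s b p.1 * qFactor₁ s (b + J) p.2)))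
    (hE : ∀ Δ : ℝ, e₁ ≤ Δ → Δ ≤ e₂ → ∃ N : ℕ, E₀ ≤ N ∧
      0 ≤ taylorFunctional2D (1 / 2) S w (crossF s (-1) (QN N 0 Δ)))
    (hC0 : ∀ Δ : ℝ, G ≤ Δ → Δ < E₀ → ∃ N : ℕ, E₀ ≤ N ∧
      0 ≤ taylorFunctional2D (1 / 2) S w (crossF s (-1) (QN N 0 Δ)))
    (hT : ∃ N : ℕ, E₀ ≤ N ∧ 0 ≤ taylorFunctional2D (1 / 2) S w (crossF s (-1) (QN N 2 2)))
    (hC2 : ∀ Δ : ℝ, 2 + δ ≤ Δ → Δ < E₀ → ∃ N : ℕ, E₀ ≤ N ∧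
      0 ≤ taylorFunctional2D (1 / 2) S w (crossF s (-1) (QN N 2 Δ)))
    (hCℓ : ∀ ℓ : ℕ, Even ℓ → ℓ ≠ 0 → ℓ ≠ 2 → ∀ Δ : ℝ, (ℓ : ℝ) ≤ Δ → Δ < E₀ → ∃ N : ℕ, E₀ ≤ N ∧
      0 ≤ taylorFunctional2D (1 / 2) S w (crossF s (-1) (QN N ℓ Δ))) :
    BoxObligations (taylorFunctional2D (1 / 2) S w) s G δ e₁ e₂ E₀ := by
  have hφ := isTaylorFunctional_taylorFunctional2D (1 / 2) S w
  have hx0 : (0 : ℝ) < 1 / 2 := by norm_num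
  have hx1 : (1 / 2 : ℝ) < 1 := by norm_num
  have hpair : PairPositiveAbove (taylorFunctional2D (1 / 2) S w) s E₀ :=
    pairPositiveAbove_half_of_poly S w hR
  -- every obligation below `E₀` by truncation at its witness; a cell point with `Δ ≥ E₀` directly by (R)
  have hcell : ∀ (ℓ : ℕ) (Δ : ℝ), (ℓ : ℝ) ≤ Δ →
      (∃ N : ℕ, E₀ ≤ N ∧ 0 ≤ taylorFunctional2D (1 / 2) S w (crossF s (-1) (QN N ℓ Δ))) →
      BlockPositive (taylorFunctional2D (1 / 2) S w) s Δ ℓ := by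
    intro ℓ Δ hℓΔ hQ
    rcases le_or_gt E₀ Δ with hge | hlt
    · exact high_nonneg_of_pairPositive_taylor hφ hx0 hx1 hpair ℓ Δ hℓΔ hge
    · obtain ⟨N, hN, h⟩ := hQ
      have : (0 : ℝ) ≤ ℓ := Nat.cast_nonneg ℓ
      exact blockPositive_of_QN_nonneg_taylor hφ hx0 hx1 hpair (N := N) hℓΔ (by linarith) h
  refine ⟨hI, ?_, ?_, ?_, ?_, ?_, ?_⟩
  · intro Δ h1 h2
    exact hcell 0 Δ (by simp only [Nat.cast_zero]; linarith) (hE Δ h1 h2)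
  · intro Δ h1 h2
    exact hcell 0 Δ (by simp only [Nat.cast_zero]; linarith) (hC0 Δ h1 h2)
  · exact hcell 2 2 (by norm_num) hT
  · intro Δ h1 h2
    exact hcell 2 Δ (by push_cast; linarith) (hC2 Δ h1 h2)
  · intro ℓ hℓ hℓ0 hℓ2 Δ hℓΔ hΔE
    exact hcell ℓ Δ hℓΔ (hCℓ ℓ hℓ hℓ0 hℓ2 Δ hℓΔ hΔE)
  · exact fun ℓ _ Δ hℓΔ hge => high_nonneg_of_pairPositive_taylor hφ hx0 hx1 hpair ℓ Δ hℓΔ hge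

/-- **Kind `box` at `(1/2,1/2)`, explicit form with per-cell truncation orders ⇒ location-wise exclusion
of the whole box** (what the class-1 cover consumes), for `G > 2s`, `s < 1`, any box with `e₁ ≥ 0`.
PROVED (`boxObligations_half_of_explicitN` + `BoxObligations.excludedOn_taylor`). [cite: RattazziEtAl2008, §5.5] -/
theorem excludedOn_half_of_explicitN (S : Finset (ℕ × ℕ)) (w : ℕ × ℕ → ℝ)
    {s G δ e₁ e₂ E₀ : ℝ} (hs1 : s < 1) (hG : 2 * s < G) (he₁ : 0 ≤ e₁) (hG0 : 0 ≤ G) (hδ : 0 ≤ δ)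
    (hI : 0 < taylorFunctional2D (1 / 2) S w (crossF s (-1) (fun _ _ => (1 : ℝ))))
    (hR : ∀ (b : ℝ) (J : ℕ), 0 ≤ b → E₀ ≤ 2 * b + J →
      0 ≤ ∑ p ∈ S, w p * ((1 - (-1 : ℝ) ^ (p.1 + p.2)) * 2 ^ (p.1 + p.2) *
        (qFactor₁ s (b + J) p.1 * qFactor₁ s b p.2 + qFactor₁ s b p.1 * qFactor₁ s (b + J) p.2)))
    (hE : ∀ Δ : ℝ, e₁ ≤ Δ → Δ ≤ e₂ → ∃ N : ℕ, E₀ ≤ N ∧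
      0 ≤ taylorFunctional2D (1 / 2) S w (crossF s (-1) (QN N 0 Δ)))
    (hC0 : ∀ Δ : ℝ, G ≤ Δ → Δ < E₀ → ∃ N : ℕ, E₀ ≤ N ∧
      0 ≤ taylorFunctional2D (1 / 2) S w (crossF s (-1) (QN N 0 Δ)))
    (hT : ∃ N : ℕ, E₀ ≤ N ∧ 0 ≤ taylorFunctional2D (1 / 2) S w (crossF s (-1) (QN N 2 2)))
    (hC2 : ∀ Δ : ℝ, 2 + δ ≤ Δ → Δ < E₀ → ∃ N : ℕ, E₀ ≤ N ∧
      0 ≤ taylorFunctional2D (1 / 2) S w (crossF s (-1) (QN N 2 Δ)))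
    (hCℓ : ∀ ℓ : ℕ, Even ℓ → ℓ ≠ 0 → ℓ ≠ 2 → ∀ Δ : ℝ, (ℓ : ℝ) ≤ Δ → Δ < E₀ → ∃ N : ℕ, E₀ ≤ N ∧
      0 ≤ taylorFunctional2D (1 / 2) S w (crossF s (-1) (QN N ℓ Δ))) :
    ExcludedOn s G δ (Icc e₁ e₂) :=
  (boxObligations_half_of_explicitN S w he₁ hG0 hδ hI hR hE hC0 hT hC2 hCℓ).excludedOn_taylor
    (isTaylorFunctional_taylorFunctional2D (1 / 2) S w) (by norm_num) (by norm_num) hG hs1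

/-- **Kind `box` at `(1/2,1/2)`, explicit form with per-cell truncation orders ⇒ `BoxExcluded`** for boxes
above `2s` (`e₁ > 2s`, `G > 2s`, `s < 1`). PROVED. [cite: RattazziEtAl2008, §5.5] -/
theorem boxExcluded_half_of_explicitN (S : Finset (ℕ × ℕ)) (w : ℕ × ℕ → ℝ)
    {s G δ e₁ e₂ E₀ : ℝ} (hs1 : s < 1) (he : 2 * s < e₁) (hG : 2 * s < G) (he₁ : 0 ≤ e₁)
    (hG0 : 0 ≤ G) (hδ : 0 ≤ δ)
    (hI : 0 < taylorFunctional2D (1 / 2) S w (crossF s (-1) (fun _ _ => (1 : ℝ))))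
    (hR : ∀ (b : ℝ) (J : ℕ), 0 ≤ b → E₀ ≤ 2 * b + J →
      0 ≤ ∑ p ∈ S, w p * ((1 - (-1 : ℝ) ^ (p.1 + p.2)) * 2 ^ (p.1 + p.2) *
        (qFactor₁ s (b + J) p.1 * qFactor₁ s b p.2 + qFactor₁ s b p.1 * qFactor₁ s (b + J) p.2)))
    (hE : ∀ Δ : ℝ, e₁ ≤ Δ → Δ ≤ e₂ → ∃ N : ℕ, E₀ ≤ N ∧
      0 ≤ taylorFunctional2D (1 / 2) S w (crossF s (-1) (QN N 0 Δ)))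
    (hC0 : ∀ Δ : ℝ, G ≤ Δ → Δ < E₀ → ∃ N : ℕ, E₀ ≤ N ∧
      0 ≤ taylorFunctional2D (1 / 2) S w (crossF s (-1) (QN N 0 Δ)))
    (hT : ∃ N : ℕ, E₀ ≤ N ∧ 0 ≤ taylorFunctional2D (1 / 2) S w (crossF s (-1) (QN N 2 2)))
    (hC2 : ∀ Δ : ℝ, 2 + δ ≤ Δ → Δ < E₀ → ∃ N : ℕ, E₀ ≤ N ∧
      0 ≤ taylorFunctional2D (1 / 2) S w (crossF s (-1) (QN N 2 Δ)))
    (hCℓ : ∀ ℓ : ℕ, Even ℓ → ℓ ≠ 0 → ℓ ≠ 2 → ∀ Δ : ℝ, (ℓ : ℝ) ≤ Δ → Δ < E₀ → ∃ N : ℕ, E₀ ≤ N ∧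
      0 ≤ taylorFunctional2D (1 / 2) S w (crossF s (-1) (QN N ℓ Δ))) :
    BoxExcluded s G δ e₁ e₂ :=
  (boxObligations_half_of_explicitN S w he₁ hG0 hδ hI hR hE hC0 hT hC2 hCℓ).boxExcluded_taylor
    (isTaylorFunctional_taylorFunctional2D (1 / 2) S w) (by norm_num) (by norm_num) he hG hs1

end Summit.CriticalPhenomena.Ising3D.Control2D
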